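import Summits.HubbardSuperconductivity.HubbardSuperconductivity.Theorems.DeformationLadderLowEnergyRigidityTelescopeReduction

/-!
# Line `Sketch` (poincare-telescope spine) — skeleton for the crux `LowEnergyRigidity`
(item stmt-HubbardSuperconductivity-1892, route `DeformationLadder`), line lead c1, 2026-08-16, rev 3.

History: rev 1 registered `stub_topPoincare`, `stub_chain`, `stub_josephson`, `stub_floor`; the first two LANDED
(`Theorems/DeformationLadderLowEnergyRigidityStubTopPoincare.lean` p120045, `…StubChain.lean` p120400). Rev 2 folded them
with the budget bookkeeping into `stub_reduction`, which LANDED as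
`Theorems/DeformationLadderLowEnergyRigidityTelescopeReduction.lean` (p120903, with the by-name corollary
`lowEnergyRigidity_of_josephson_of_floor`). Rev 2b carried that reduction inline; rev 3 (this file) IMPORTS the landed
module, so the skeleton is exactly: two open stubs + the landed composition. RESIDUAL = the two OPEN inputs of the card
at the line's point `(U, δ) = (3, 3/10)`:
* `stub_josephson` — OPEN INPUT 1 (the `O(1)` stiffness content; crux-sized).
* `stub_floor` — OPEN INPUT 2 (thermodynamic coherence floor, scale-unbounded).
Composition: `LowEnergyRigidity_of` from `Telescope.lowEnergyRigidity_of_josephson_of_floor` at `(3, 3/10)`.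
-/

noncomputable section

namespace Summit.HubbardSuperconductivity.HubbardSuperconductivity.Cruxes.LowEnergyRigidity.Sketch

set_option linter.dupNamespace false

open Matrix
open scoped ComplexOrder
open Literature.MathematicalPhysics.QuantumLattice Literature.Probability.LatticeModels
open Summit.HubbardSuperconductivity.HubbardSuperconductivity.Theses.DeformationLadder
open Summit.HubbardSuperconductivity.HubbardSuperconductivity.Theorems.LowEnergyRigidity.Telescope

/-! ### Registered stubs (signatures over tree vocabulary; sorries ONLY here) -/

/-- STUB `stub_josephson` (OPEN INPUT 1, conjecture-grade — the `O(1)` stiffness content of the crux): the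
Josephson family `JosephsonInequalityAt` at the line's point `(U, δ) = (3, 3/10)` for SOME rate `J > 0`, slack
constant `C` and bottom scale `ℓ₁ > 0`. -/
theorem stub_josephson :
    ∃ J : ℝ, 0 < J ∧ ∃ C : ℝ, ∃ ℓ₁ : ℕ, 0 < ℓ₁ ∧ JosephsonInequalityAt 3 (3 / 10) J C ℓ₁ := by
  sorry

/-- STUB `stub_floor` (OPEN INPUT 2, conjecture-grade — thermodynamic): the coherence floor
`CoherenceFloorAt` at `(U, δ) = (3, 3/10)` with ONE floor `r₀ > 0` on an unbounded set of lattice scales `ℓ₀`. -/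
theorem stub_floor :
    ∃ r₀ : ℝ, 0 < r₀ ∧ ∀ n : ℕ, ∃ ℓ₀ : ℕ, n ≤ ℓ₀ ∧ CoherenceFloorAt 3 (3 / 10) r₀ ℓ₀ := by
  sorry

/-! ### The composition -/

/-- **Composition of the line** (kernel-checked): the two open stubs give the crux BY NAME at `U = 3`, `δ = 3/10`
through the telescope's landed reduction `lowEnergyRigidity_of_josephson_of_floor` (p120903). -/
theorem LowEnergyRigidity_of : LowEnergyRigidity :=
  lowEnergyRigidity_of_josephson_of_floor (U := 3) (δ := 3 / 10) (by norm_num) (by norm_num)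
    stub_josephson stub_floor

end Summit.HubbardSuperconductivity.HubbardSuperconductivity.Cruxes.LowEnergyRigidity.Sketch
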